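/-
Copyright (c) 2026 the pub-hodgecm-mathlib formalisation cell (harness21).  Prover seat hodgecm-mathlib-K2E3-p37 (g0), Track B «K2-LIT» ∕ h413 =
`stmt-HodgeConjecture-24833`, line `K2_E3_EllipticInputs`, unit U4 «Keys», PART «U4Keys» socket :182 (U4f-χ₁-ram-one-pos)
`sig_K2E3KeysThmTwoContractingRamifiedCharOnePosDepth` (LINE-LEAD K2E3-plan (g4) L4∕E3 EMIT #5 deal D163 2026-09-04T15:31:56Z; R0 census + addenda §6–§9
`K2/K2E3-p37/g0/CENSUS-U4f-PosDepth.K2E3-p37-g0.md`): programme A_pos brick (iii)-X «THE DEPTH WITNESS OF FAMILY X» — for an intermediate lower unipotent `ū(x, z)` with `x`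
shallow (`|ϖ|ᵐ ≤ |x|`, `|z| ≤ |x||ϖ|`, `|z||ϖ|^{m+1} ≤ (|x||ϖ|)²`) and ANY `c ∈ 𝔭ᵐ`, the element `u(y, b)`, `y = −c∕σx`, `b = −yσy∕2`, conjugates into `J_{m+1}` with `(0,0)` entry
`(1 + c)(1 + ε)`, `ε ∈ 𝔭^{m+1}`.  REPORT-FIRST 2026-09-04.
-/
import Summits.HodgeConjecture.HodgeConjecture.Theorems.K2E3LevelNDepthWitnessZ   -- ★∕📤 p861978 (this seat): `le_of_mul_le_mul_v`; brings ★ p861919 (entries of `ū⁻¹ u ū`), ★ p861613, ★ p861548, ★ BigCell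
import HarnessLib

/-!
# K2 ∕ E3 «EllipticInputs», unit U4 «Keys» — (U4f-χ₁-ram-one-pos), programme A_pos brick (iii)-X: THE DEPTH WITNESS ON AN INTERMEDIATE CELL, FAMILY X
# «`ū = ū(x,z)`, `|ϖ|ᵐ ≤ |x| ≤ |ϖ|`, `|z| ≤ |x||ϖ|`, `|z||ϖ|^{m+1} ≤ (|x||ϖ|)²`, `|c| ≤ |ϖ|ᵐ`, `|2| = 1` ⟹ `u := u(y, b)`, `y = −c∕σx`, `b = −yσy∕2`: `u ∈ N ∩ K₀`, `ū⁻¹ u ū ∈ J_{m+1}`,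
#  `(ū⁻¹ u ū)₀₀ = (1 + c)(1 + ε)` with `|ε| ≤ |ϖ|^{m+1}`»   [Roche1998 §4; Casselman1995 §6.3; Rogawski1990 §1.10]

Cell hodgecm-mathlib, Track B «K2-LIT», crux item H413 = stmt-HodgeConjecture-24833 (route `HCCMUnconditional`, no route verbs); target BY NAME the OPEN tier-0 leaf
`…K2E3EllipticInputs.U4Keys.sig_K2E3KeysThmTwoContractingRamifiedCharOnePosDepth` (U4Keys ED. 8 :182), design D-I «vanishing functional» at POSITIVE depth (memo §9 cases (2), (3)).
Author K2E3-p37 (g0).  `--supports stmt-HodgeConjecture-24833 --as helper`; THEOREMS ONLY; MODEL level.  NOT THE PAYER.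

THE POINT.  Companion of ★∕📤 p861978 (family Z).  For `ū(x, z)` (`z + σz + xσx = 0`) OFF `J_{m+1}` through its `x`-coordinate (`|ϖ|ᵐ ≤ |x|`, `x ≠ 0`) in the regime
`|z| ≤ |x||ϖ|` and `|z||ϖ|^{m+1} ≤ (|x||ϖ|)²` (memo §9: `ord z ≥ ord x + 1`, `ord z ≥ 2 ord x + 2 − (m+1)` — cases (2), (3)), and ANY `c` with `|c| ≤ |ϖ|ᵐ` (no `σ`-fixedness: this
family sees the full conductor of `χ₁`), put `y := −c∕σx` (so `y·σx = −c`), `b := −yσy∕2` (`σb = b`, `b + σb + yσy = 0`), `u := u(y, b) ∈ N` (★ `exists_upper_of_rel`), `j := ū⁻¹ u ū`.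
By ★ p861919: `j₀₀ = 1 + c + bz`, `j₁₀ = −y(σx)² + σx·b·z − σy·z`, `j₂₀ = σz·b·z + x·σy·z − σz·y·σx`, `j₂₁ = σz·y + σz·b·x + x²·σy`; with `|y||x| = |c|`, `|b| = |y|²` every term is
`≤ |ϖ|^{m+1}` (the nine bounds of §1, all by «multiply through by a power of `|x|` and cancel», ★ `le_of_mul_le_mul_v`), `|bz| ≤ |ϖ|^{m+1}`, `u, ū` integral; so `j ∈ J_{m+1}` (★ test)
and `j₀₀ = (1 + c)(1 + ε)`, `ε = bz∕(1+c)`.  Hence `θ(j) = χ₁(1 + c)`: choosing `c` with `χ₁(1 + c) ≠ 1` (exact conductor `m + 1`) makes the cell `P·ū·J_{m+1}` θ-IRRELEVANT.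
* §1 `familyX_rel`, the valuation bounds `familyX_v_y_mul`, `familyX_v_*`.
* §2 **`exists_familyX_witness`**.
HONEST LABEL: HC_CM is proved only modulo the 7 printed citations (2 remaining named inputs: hLiu418 = stmt-HodgeConjecture-24832, h413 = stmt-HodgeConjecture-24833)
until rung 0 closes; count-neutral — this file does NOT pay the leaf; no printed citation is discharged.

## References
* [Roche1998] A. Roche, *Types and Hecke algebras for principal series representations of split reductive p-adic groups*, Ann. Sci. ÉNS (4) 31 (1998), §4.
* [Casselman1995] W. Casselman, *Introduction to the theory of admissible representations of `p`-adic reductive groups* (1995), §6.3.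
* [Rogawski1990] J. D. Rogawski, *Automorphic Representations of Unitary Groups in Three Variables*, Ann. of Math. Stud. 123 (1990), §1.9–§1.10 pp. 8–9.
* [Serre1979] J.-P. Serre, *Local Fields*, GTM 67 (1979), Ch. II §1.
-/

set_option autoImplicit false
-- the mandated namespace repeats the single-problem summit's segment (`HodgeConjecture.HodgeConjecture`)
set_option linter.dupNamespace false

noncomputable section

open Matrix Literature.NumberTheory.Automorphic Literature.NumberTheory.Automorphic.UnitaryGroup
open scoped Matrix MatrixGroups WithZero Pointwise

namespace Summit.HodgeConjecture.HodgeConjecture.Cruxes.H413.K2E3LevelNDepthWitnessX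

open Summit.HodgeConjecture.HodgeConjecture.Cruxes.H413
open Summit.HodgeConjecture.HodgeConjecture.Cruxes.H413.K2E3LevelNDepthWitnessZ

/-! ## §1 Algebra and valuations of family X -/

section Algebra

variable {K : Type*} [Field K] (σ : K →+* K) (hσ : ∀ a, σ (σ a) = a)

include hσ in
/-- **Family X lies in `N`**: for `b := −yσy∕2`, `σb = b` and `b + σb + yσy = 0`. [cite: Rogawski1990, §1.10 p. 9] -/
theorem familyX_rel {y b : K} (hb : b = -(y * σ y) / 2) (h2 : (2 : K) ≠ 0) : b + σ b + y * σ y = 0 := by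
  rw [hb, map_div₀, map_neg, map_mul, hσ, map_ofNat]
  field_simp
  ring

/-- `y·σx = −c` for `y = −c∕σx` (`σx ≠ 0`). [cite: Rogawski1990, §1.10 p. 9] -/
theorem familyX_y_mul {c x y : K} (hy : y = -c / σ x) (hσx : σ x ≠ 0) : y * σ x = -c := by
  rw [hy, div_mul_cancel₀ _ hσx]

end Algebra

section Valuation

variable {K : Type*} [Field K] [Valued K ℤᵐ⁰] [ValuativeRel K] [(Valued.v : Valuation K ℤᵐ⁰).Compatible]
  (σ : K →+* K) {ϖ : K} {J : Matrix (Fin 3) (Fin 3) K} (hJ : J = (StdForm.antidiagonal 3).over K)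
  (hσ : ∀ a, σ (σ a) = a) (hvσ : ∀ a, Valued.v (σ a) = Valued.v a) (hvϖ : Valued.v ϖ = WithZero.exp (-1 : ℤ))
  {m : ℕ} (gn : GL (Fin 3) K) (hgn : (gn : Matrix (Fin 3) (Fin 3) K) = Matrix.diagonal ![(1 : K), 1, ϖ ^ (m + 1)])

omit [ValuativeRel K] [(Valued.v : Valuation K ℤᵐ⁰).Compatible] in
include hvσ in
/-- **The valuations of `y` and `b`**: `|y|·|x| = |c|`, `|b| = |y|²` (`|2| = 1`). [cite: Serre1979, Ch. II §1] -/
theorem familyX_v_y_mul {c x y b : K} (hy : y = -c / σ x) (hb : b = -(y * σ y) / 2) (hx0 : x ≠ 0) (h2 : Valued.v (2 : K) = 1) :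
    Valued.v y * Valued.v x = Valued.v c ∧ Valued.v b = Valued.v y * Valued.v y := by
  have hσx : σ x ≠ 0 := (map_ne_zero σ).2 hx0
  refine ⟨?_, ?_⟩
  · rw [← hvσ x, ← map_mul, familyX_y_mul σ hy hσx, Valuation.map_neg]
  · rw [hb, map_div₀, Valuation.map_neg, map_mul, hvσ, h2, div_one]

omit [ValuativeRel K] [(Valued.v : Valuation K ℤᵐ⁰).Compatible] in
/-- **The master bound `|c|²·|z| ≤ |ϖ|^{m+1}·|x|²`** in the regime `|z|·|ϖ|^{m+1} ≤ (|x||ϖ|)²`, `|c| ≤ |ϖ|ᵐ` — whence `|b z| ≤ |ϖ|^{m+1}` and `|σx·b·z| ≤ |ϖ|^{m+1}·|x|`.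
[cite: Serre1979, Ch. II §1] -/
theorem familyX_master {c x z : K} (hc : Valued.v c ≤ Valued.v ϖ ^ m) (hz2 : Valued.v z * Valued.v ϖ ^ (m + 1) ≤ (Valued.v x * Valued.v ϖ) ^ 2)
    (hvϖ0 : Valued.v ϖ ≠ 0) :
    Valued.v c * Valued.v c * Valued.v z ≤ Valued.v ϖ ^ (m + 1) * (Valued.v x * Valued.v x) := by
  -- multiply through by `|ϖ|^{m+1}` and cancel
  have hP : Valued.v ϖ ^ (m + 1) ≠ 0 := pow_ne_zero _ hvϖ0
  refine le_of_mul_le_mul_v (C := Valued.v ϖ ^ (m + 1)) ?_ hP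
  calc Valued.v c * Valued.v c * Valued.v z * Valued.v ϖ ^ (m + 1)
      = Valued.v c * Valued.v c * (Valued.v z * Valued.v ϖ ^ (m + 1)) := by rw [mul_assoc]
    _ ≤ Valued.v ϖ ^ m * Valued.v ϖ ^ m * (Valued.v x * Valued.v ϖ) ^ 2 := mul_le_mul' (mul_le_mul' hc hc) hz2
    _ = Valued.v ϖ ^ (m + 1) * (Valued.v x * Valued.v x) * Valued.v ϖ ^ (m + 1) := by
        rw [pow_two, pow_succ]
        simp only [mul_assoc, mul_comm, mul_left_comm]

/-! ## §2 The witness -/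

include hJ hσ hvσ hvϖ hgn in
set_option maxHeartbeats 1600000 in
-- one `u ∈ N`, its conjugate's four entries, ten valuation bounds
/-- **THE DEPTH WITNESS OF FAMILY X.**  `ū ∈ U(σ, Φ₃)` with matrix `ū(x, z)` (`z + σz + xσx = 0`), `|ϖ|ᵐ ≤ |x| ≤ |ϖ|`, `|z| ≤ |x|·|ϖ|`, `|z|·|ϖ|^{m+1} ≤ (|x|·|ϖ|)²`; ANY `c`
with `|c| ≤ |ϖ|ᵐ`; `|2| = 1`; `1 ≤ m`.  Then there is `u ∈ N` (matrix `u(y, b)`, `y = −c∕σx`, `b = −yσy∕2`) with `ū⁻¹ u ū ∈ J_{m+1} = K₀ ⊓ gK₀g⁻¹` (`g = diag(1,1,ϖ^{m+1})`) and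
`(ū⁻¹ u ū)₀₀ = (1 + c)(1 + ε)`, `|ε| ≤ |ϖ|^{m+1}` — so `θ(ū⁻¹ u ū) = χ₁(1 + c)` for `χ₁` of conductor `≤ m + 1` while `(χδ^{½})(u) = 1`: the cell `P·ū·J_{m+1}` is θ-IRRELEVANT as
soon as `χ₁(1 + c) ≠ 1` for some `c ∈ 𝔭ᵐ` (exact conductor `m + 1`). [cite: Roche1998, §4] [cite: Casselman1995, §6.3] [cite: Rogawski1990, §1.10 p. 9] -/
theorem exists_familyX_witness (hm : 1 ≤ m) {nb : ↥(unitaryGroupOfForm σ J)} {x z c : K}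
    (hnb : ((nb : GL (Fin 3) K) : Matrix (Fin 3) (Fin 3) K) = !![1, 0, 0; -σ x, 1, 0; z, x, 1]) (hrel : z + σ z + x * σ x = 0)
    (hx : Valued.v x ≤ Valued.v ϖ) (hxm : Valued.v ϖ ^ m ≤ Valued.v x) (hz : Valued.v z ≤ Valued.v x * Valued.v ϖ)
    (hz2 : Valued.v z * Valued.v ϖ ^ (m + 1) ≤ (Valued.v x * Valued.v ϖ) ^ 2)
    (hc : Valued.v c ≤ Valued.v ϖ ^ m) (h2 : Valued.v (2 : K) = 1) :
    ∃ u : ↥(unitaryGroupOfForm σ J), u ∈ unipotentU σ J ∧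
      nb⁻¹ * u * nb ∈ (glInt 3 K).subgroupOf (unitaryGroupOfForm σ J) ⊓ ((glInt 3 K).map (MulAut.conj gn).toMonoidHom).subgroupOf (unitaryGroupOfForm σ J) ∧
      ∃ ε : K, Valued.v ε ≤ Valued.v ϖ ^ (m + 1) ∧
        (((nb⁻¹ * u * nb : ↥(unitaryGroupOfForm σ J)) : GL (Fin 3) K) : Matrix (Fin 3) (Fin 3) K) 0 0 = (1 + c) * (1 + ε) := by
  have hϖ0 : ϖ ≠ 0 := CartanUnique.uniformizer_ne_zero hvϖ
  have hvϖ0 : Valued.v ϖ ≠ 0 := (Valuation.ne_zero_iff _).2 hϖ0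
  have hvϖ1 : Valued.v ϖ ≤ 1 := by rw [hvϖ, ← WithZero.exp_zero, WithZero.exp_le_exp]; norm_num
  have hvϖlt : Valued.v ϖ < 1 := by rw [hvϖ, ← WithZero.exp_zero, WithZero.exp_lt_exp]; norm_num
  have hvϖmlt : Valued.v ϖ ^ m < 1 := pow_lt_one' hvϖlt (Nat.one_le_iff_ne_zero.1 hm)
  have hx0 : x ≠ 0 := fun h => by
    rw [h, map_zero] at hxm
    exact absurd hxm (not_le.2 (pow_pos (zero_lt_iff.2 hvϖ0) m))
  have hvx0 : Valued.v x ≠ 0 := (Valuation.ne_zero_iff _).2 hx0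
  have hσx : σ x ≠ 0 := (map_ne_zero σ).2 hx0
  have hx1 : Valued.v x ≤ 1 := hx.trans hvϖ1
  have hzx : Valued.v z ≤ Valued.v x := hz.trans (mul_le_of_le_one_right' hvϖ1)
  have hz1 : Valued.v z ≤ 1 := hzx.trans hx1
  -- the element `u = u(y, b)`
  obtain ⟨y, hy⟩ : ∃ y : K, y = -c / σ x := ⟨_, rfl⟩
  obtain ⟨b, hb⟩ : ∃ b : K, b = -(y * σ y) / 2 := ⟨_, rfl⟩
  have h20 : (2 : K) ≠ 0 := fun h => by rw [h, map_zero] at h2; exact zero_ne_one h2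
  obtain ⟨u, huN, hu⟩ := K2E3LowerUnipotentBigCellIntegral.exists_upper_of_rel σ hJ hσ (a := y) (b := b) (familyX_rel σ hσ hb h20)
  obtain ⟨hyx, hvb⟩ := familyX_v_y_mul σ hvσ hy hb hx0 h2
  have hyc : y * σ x = -c := familyX_y_mul σ hy hσx
  -- `|y| ≤ 1`, `|b| ≤ 1`
  have hvy : Valued.v y ≤ 1 := by
    refine le_of_mul_le_mul_v (C := Valued.v x) ?_ hvx0
    rw [hyx, one_mul]; exact hc.trans hxm
  have hvb1 : Valued.v b ≤ 1 := by rw [hvb]; exact mul_le_one' hvy hvy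
  -- the master bound and its consequences: `|y|²|z|·|x| ≤ |ϖ|^{m+1}·|x|·|x|`... in the forms used below
  have hM := familyX_master hc hz2 hvϖ0
  -- `|b|·|z|·|x|² = |c|²|z|` : `|b z| · |x|·|x| ≤ |ϖ|^{m+1} · |x|·|x|`
  have hbz : Valued.v (b * z) ≤ Valued.v ϖ ^ (m + 1) := by
    refine le_of_mul_le_mul_v (C := Valued.v x * Valued.v x) ?_ (mul_ne_zero hvx0 hvx0)
    calc Valued.v (b * z) * (Valued.v x * Valued.v x) = Valued.v y * Valued.v x * (Valued.v y * Valued.v x) * Valued.v z := by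
          rw [map_mul, hvb]; simp only [mul_comm, mul_left_comm]
      _ = Valued.v c * Valued.v c * Valued.v z := by rw [hyx]
      _ ≤ Valued.v ϖ ^ (m + 1) * (Valued.v x * Valued.v x) := hM
  -- `|σx · b · z| ≤ |ϖ|^{m+1}` (one spare factor `|x| ≤ 1`)
  have hxbz : Valued.v (σ x * b * z) ≤ Valued.v ϖ ^ (m + 1) := by
    rw [mul_assoc, map_mul, hvσ]
    exact (mul_le_mul' hx1 hbz).trans_eq (one_mul _)
  -- `|y|·|σx|² = |c|·|x|`
  have hyxx : Valued.v (y * σ x * σ x) ≤ Valued.v ϖ ^ (m + 1) := by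
    rw [map_mul, map_mul, hvσ, hyx, pow_succ]
    exact mul_le_mul' hc hx
  -- `|σy · z| ≤ |ϖ|^{m+1}`: `|y||z|·|x| = |c||z| ≤ |c||x||ϖ|`
  have hyz : Valued.v (σ y * z) ≤ Valued.v ϖ ^ (m + 1) := by
    refine le_of_mul_le_mul_v (C := Valued.v x) ?_ hvx0
    rw [map_mul, hvσ, mul_assoc, mul_comm (Valued.v z), ← mul_assoc, hyx, pow_succ, mul_assoc]
    exact mul_le_mul' hc (by rw [mul_comm]; exact hz)
  have hzy : Valued.v (σ z * y) ≤ Valued.v ϖ ^ (m + 1) := by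
    rw [map_mul, hvσ, mul_comm, ← hvσ y, ← map_mul]; exact hyz
  -- `|σz · b · x| = |b z|·|x|`
  have hzbx : Valued.v (σ z * b * x) ≤ Valued.v ϖ ^ (m + 1) := by
    rw [show σ z * b * x = (b * σ z) * x by ring, map_mul, map_mul, hvσ, ← map_mul]
    exact (mul_le_mul' hbz hx1).trans_eq (mul_one _)
  -- `|x·x·σy| = |x|·|c|`
  have hxxy : Valued.v (x * x * σ y) ≤ Valued.v ϖ ^ (m + 1) := by
    rw [show x * x * σ y = x * (σ y * x) by ring, map_mul, map_mul, hvσ, hyx, pow_succ, mul_comm]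
    exact mul_le_mul' hc hx
  -- `|σz · b · z| = |bz|·|z|`
  have hzbz : Valued.v (σ z * b * z) ≤ Valued.v ϖ ^ (m + 1) := by
    rw [show σ z * b * z = (b * z) * σ z by ring, map_mul, hvσ]
    exact (mul_le_mul' hbz hz1).trans_eq (mul_one _)
  -- `|x · σy · z|`, `|σz · y · σx|`
  have hxyz : Valued.v (x * σ y * z) ≤ Valued.v ϖ ^ (m + 1) := by
    rw [show x * σ y * z = x * (σ y * z) by ring, map_mul]
    exact (mul_le_mul' hx1 hyz).trans_eq (one_mul _)
  have hzyx : Valued.v (σ z * y * σ x) ≤ Valued.v ϖ ^ (m + 1) := by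
    rw [show σ z * y * σ x = σ z * (y * σ x) by ring, hyc, map_mul, Valuation.map_neg, hvσ, pow_succ, mul_comm]
    exact mul_le_mul' hc (hzx.trans hx)
  -- `u`, `ū`, hence `j`, integral
  have hvσy : Valued.v (σ y) ≤ 1 := by rw [hvσ]; exact hvy
  have huK : (u : GL (Fin 3) K) ∈ glInt 3 K := mem_glInt_of_coe_eq σ hJ hvσ hu fun i j => by
    fin_cases i <;> fin_cases j <;> simp [hvb1, hvy, hvσy]
  have hnbK : (nb : GL (Fin 3) K) ∈ glInt 3 K := mem_glInt_of_coe_eq_lower σ hJ hvσ hnb hx1 hz1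
  have hjK : nb⁻¹ * u * nb ∈ (glInt 3 K).subgroupOf (unitaryGroupOfForm σ J) :=
    Subgroup.mul_mem _ (Subgroup.mul_mem _ (Subgroup.inv_mem _ (Subgroup.mem_subgroupOf.2 hnbK)) (Subgroup.mem_subgroupOf.2 huK))
      (Subgroup.mem_subgroupOf.2 hnbK)
  -- the entries
  have e00 := K2E3LowerUnipotentConjUpperEntries.conj_upper_apply_zero_zero_of_familyX σ hJ hσ hnb hu hyc
  have e10 := K2E3LowerUnipotentConjUpperEntries.conj_upper_apply_one_zero σ hJ hσ hnb hu
  have e20 := K2E3LowerUnipotentConjUpperEntries.conj_upper_apply_two_zero σ hJ hσ hnb hu hrel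
  have e21 := K2E3LowerUnipotentConjUpperEntries.conj_upper_apply_two_one σ hJ hσ hnb hu
  refine ⟨u, huN, ?_, ?_⟩
  · rw [K2E3IwahoriLevelNFactorisation.mem_glInt_inf_conj_glInt_pow_iff σ hJ hvσ hvϖ gn hgn]
    refine ⟨(mem_glInt_subgroupOf_iff σ hJ hvσ _).1 hjK, ?_, ?_, ?_⟩
    · rw [e20]
      refine Valued.v.map_sub_le (Valued.v.map_add_le hzbz hxyz) hzyx
    · rw [e21]
      exact Valued.v.map_add_le (Valued.v.map_add_le hzy hzbx) hxxy
    · rw [e10]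
      refine Valued.v.map_sub_le (Valued.v.map_add_le ?_ hxbz) hyz
      rw [Valuation.map_neg]; exact hyxx
  · have hclt : Valued.v c < Valued.v (1 : K) := by rw [Valuation.map_one]; exact lt_of_le_of_lt hc hvϖmlt
    have h1c : Valued.v (1 + c) = 1 := by rw [Valuation.map_add_eq_of_lt_left _ hclt, Valuation.map_one]
    have h1c0 : (1 + c : K) ≠ 0 := fun h => by rw [h, map_zero] at h1c; exact zero_ne_one h1c
    refine ⟨b * z / (1 + c), ?_, ?_⟩
    · rw [map_div₀, h1c, div_one]; exact hbz
    · rw [e00]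
      field_simp

end Valuation

end Summit.HodgeConjecture.HodgeConjecture.Cruxes.H413.K2E3LevelNDepthWitnessX

end
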